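import Mathlib
import Summits.AtomisticToContinuum.Crystallization.Theorems.NashClassCertificatesNashNearFieldStubTriLandscapeNearObliqueReduction

/-!
# Crux `NashNearField` (16827), stub `stub_triLandscapeNearOblique` (NEAR′): the admissible set of the certificate —
# clip/oblique case analysis, signs of the tangential strains on the box edges, and the size of the oblique strain `S′`

The NEAR′ certificate is organised by the position of the selected cell `(a′, h′)` in the box and by the signs of the two TANGENTIAL
strain components `α = (t₀₀ + t₁₁)/2 − a′`, `β = t₂₂ − h′/h₀` (`h₀ = √6/3`); this file pins that case analysis down once:
* `tri_clip_le` / `tri_le_clip` — a clipped value `max lo (min hi x)` is `≤ x` unless it sits at the lower end and `≥ x` unless it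
  sits at the upper end; hence (`tri_clip_a_signs`, `tri_clip_h_signs`) for `a = max (47/50) (min 1 ā)`: `47/50 < a → a ≤ ā` and
  `a < 1 → ā ≤ a`, and the same for `h′` against `h₀t₂₂` on `[39a′/50, 17a′/20]`: interior cells carry NO tangential strain, the
  left/bottom edges carry `α ≤ 0` / `β ≤ 0`, the right/top edges `α ≥ 0` / `β ≥ 0`;
* `tri_oblique_inactive` — below the top edge (`h₀t₂₂ ≤ 17a/20`) the oblique cell is the clipped cell (`a′ = a`, `h′ = h`);
* `tri_oblique_active` — above it: `h′ = 17a′/20`, `a′ = min 1 (a + ω/4)` with the overshoot `ω = h₀t₂₂ − 17a/20 > 0`, `β > 0`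
  (`17a′/20 < h₀t₂₂`), and `ω ≤ h₀/10` on the clip-near region;
* `tri_oblique_Sprime_sq_le` — the oblique squared distance exceeds the clip squared distance by at most `1/100`
  (so `S′² ≤ 1/50` on the near region `S² ≤ 1/100`).
-/

noncomputable section

open Literature.MathematicalPhysics.StatisticalMechanics

namespace Summit.AtomisticToContinuum.Crystallization.Theorems.NashClassCertificatesNashNearField

/-- A clipped value above the lower end is below the raw value: `lo < max lo (min hi x) → max lo (min hi x) ≤ x`. [folklore] -/
theorem tri_clip_le {lo hi x : ℝ} (h : lo < max lo (min hi x)) : max lo (min hi x) ≤ x := by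
  rcases le_or_gt (min hi x) lo with h1 | h1
  · rw [max_eq_left h1] at h; exact absurd h (lt_irrefl _)
  · rw [max_eq_right h1.le]; exact min_le_right _ _

/-- A clipped value below the upper end is above the raw value: `max lo (min hi x) < hi → x ≤ max lo (min hi x)` (`lo ≤ hi`). [folklore] -/
theorem tri_le_clip {lo hi x : ℝ} (h : max lo (min hi x) < hi) : x ≤ max lo (min hi x) := by
  rcases le_or_gt hi x with h1 | h1
  · rw [min_eq_left h1] at h
    exact absurd (le_max_right lo hi) (not_le.2 h)
  · rw [min_eq_right h1.le]; exact le_max_right _ _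

/-- **Signs of `α` on the `a`-edges of the box.**  For `a = max (47/50) (min 1 ā)`: right of the left edge the cell is not above the raw
value (`47/50 < a → a ≤ ā`), left of the right edge not below it (`a < 1 → ā ≤ a`); so `ā = a` strictly inside. [folklore] -/
theorem tri_clip_a_signs {t₀₀ t₁₁ a : ℝ} (ha : a = max (47 / 50) (min 1 ((t₀₀ + t₁₁) / 2))) :
    (47 / 50 < a → a ≤ (t₀₀ + t₁₁) / 2) ∧ (a < 1 → (t₀₀ + t₁₁) / 2 ≤ a) := by
  constructor
  · intro h; rw [ha] at h ⊢; exact tri_clip_le h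
  · intro h; rw [ha] at h ⊢; exact tri_le_clip h

/-- **Signs of `β` on the `h`-edges**: for `h′ = max (39a′/50) (min (17a′/20) (h₀t₂₂))`, `39a′/50 < h′ → h′ ≤ h₀t₂₂` (so `β ≥ 0` unless on
the bottom edge) and `h′ < 17a′/20 → h₀t₂₂ ≤ h′` (so `β ≤ 0` unless on the top edge). [folklore] -/
theorem tri_clip_h_signs {t₂₂ a' h' : ℝ} (hh' : h' = max (39 / 50 * a') (min (17 / 20 * a') (Real.sqrt 6 / 3 * t₂₂))) :
    (39 / 50 * a' < h' → h' ≤ Real.sqrt 6 / 3 * t₂₂) ∧ (h' < 17 / 20 * a' → Real.sqrt 6 / 3 * t₂₂ ≤ h') := by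
  constructor
  · intro h; rw [hh'] at h ⊢; exact tri_clip_le h
  · intro h; rw [hh'] at h ⊢; exact tri_le_clip h

/-- **Below the top edge the oblique cell is the clipped cell.** [folklore] -/
theorem tri_oblique_inactive {t₂₂ a h a' h' : ℝ} (hh : h = max (39 / 50 * a) (min (17 / 20 * a) (Real.sqrt 6 / 3 * t₂₂)))
    (ha' : a' = min 1 (a + 1 / 4 * max 0 (Real.sqrt 6 / 3 * t₂₂ - 17 / 20 * a)))
    (hh' : h' = max (39 / 50 * a') (min (17 / 20 * a') (Real.sqrt 6 / 3 * t₂₂))) (ha1 : a ≤ 1)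
    (hω : Real.sqrt 6 / 3 * t₂₂ ≤ 17 / 20 * a) : a' = a ∧ h' = h := by
  have e : max 0 (Real.sqrt 6 / 3 * t₂₂ - 17 / 20 * a) = 0 := max_eq_left (by linarith)
  have ha'a : a' = a := by rw [ha', e, mul_zero, add_zero, min_eq_right ha1]
  exact ⟨ha'a, by rw [hh', hh, ha'a]⟩

/-- **Above the top edge**: the overshoot `ω = h₀t₂₂ − 17a/20 > 0` puts the oblique cell ON the top edge, `h′ = 17a′/20`, with
`a′ = min 1 (a + ω/4)` and `β > 0` (`17a′/20 < h₀t₂₂`). [folklore] -/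
theorem tri_oblique_active {t₂₂ a a' h' : ℝ}
    (ha' : a' = min 1 (a + 1 / 4 * max 0 (Real.sqrt 6 / 3 * t₂₂ - 17 / 20 * a)))
    (hh' : h' = max (39 / 50 * a') (min (17 / 20 * a') (Real.sqrt 6 / 3 * t₂₂))) (ha0 : 0 ≤ a) (ha1 : a ≤ 1)
    (hω : 17 / 20 * a < Real.sqrt 6 / 3 * t₂₂) :
    a' = min 1 (a + 1 / 4 * (Real.sqrt 6 / 3 * t₂₂ - 17 / 20 * a)) ∧ a ≤ a' ∧ a' ≤ a + 1 / 4 * (Real.sqrt 6 / 3 * t₂₂ - 17 / 20 * a) ∧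
      17 / 20 * a' < Real.sqrt 6 / 3 * t₂₂ ∧ h' = 17 / 20 * a' := by
  have e : max 0 (Real.sqrt 6 / 3 * t₂₂ - 17 / 20 * a) = Real.sqrt 6 / 3 * t₂₂ - 17 / 20 * a := max_eq_right (by linarith)
  rw [e] at ha'
  have h1 : a ≤ a' := by rw [ha']; exact le_min ha1 (by linarith)
  have h2 : a' ≤ a + 1 / 4 * (Real.sqrt 6 / 3 * t₂₂ - 17 / 20 * a) := by rw [ha']; exact min_le_right _ _
  have h3 : 17 / 20 * a' < Real.sqrt 6 / 3 * t₂₂ := by nlinarith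
  refine ⟨ha', h1, h2, h3, ?_⟩
  rw [hh', min_eq_left h3.le, max_eq_right (by nlinarith)]

/-- **The overshoot is at most `h₀/10` on the clip-near region**: above the top edge `h = 17a/20`, so `ω/h₀ = t₂₂ − h/h₀` and
`(t₂₂ − h/h₀)² ≤ 1/100` bounds it. [folklore] -/
theorem tri_oblique_overshoot_le {t₂₂ a h : ℝ} (hh : h = max (39 / 50 * a) (min (17 / 20 * a) (Real.sqrt 6 / 3 * t₂₂)))
    (ha0 : 0 ≤ a) (hω : 17 / 20 * a < Real.sqrt 6 / 3 * t₂₂) (hS : (t₂₂ - h / (Real.sqrt 6 / 3)) ^ 2 ≤ 1 / 100) :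
    h = 17 / 20 * a ∧ Real.sqrt 6 / 3 * t₂₂ - 17 / 20 * a ≤ Real.sqrt 6 / 3 / 10 := by
  have h6 : 0 < Real.sqrt 6 / 3 := by positivity
  have hh' : h = 17 / 20 * a := by rw [hh, min_eq_left hω.le, max_eq_right (by nlinarith)]
  refine ⟨hh', ?_⟩
  have hab : |t₂₂ - h / (Real.sqrt 6 / 3)| ≤ 1 / 10 := by
    rw [show (1 / 10 : ℝ) = |1 / 10| by norm_num]
    exact sq_le_sq.1 (by norm_num; linarith)
  have h1 : t₂₂ - h / (Real.sqrt 6 / 3) ≤ 1 / 10 := (abs_le.1 hab).2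
  have h2 : Real.sqrt 6 / 3 * (t₂₂ - h / (Real.sqrt 6 / 3)) ≤ Real.sqrt 6 / 3 * (1 / 10) := mul_le_mul_of_nonneg_left h1 h6.le
  have e : Real.sqrt 6 / 3 * (t₂₂ - h / (Real.sqrt 6 / 3)) = Real.sqrt 6 / 3 * t₂₂ - h := by field_simp
  rw [e, hh'] at h2
  linarith

/-- **The oblique squared distance exceeds the clip squared distance by at most `1/100`** (diagonal part; the off-diagonal squares
are common to both): with `S² ≤ 1/100` this gives `S′² ≤ 1/50`. [folklore] -/
theorem tri_oblique_Sprime_sq_le {t₀₀ t₁₁ t₂₂ a h a' h' : ℝ} (ha : a = max (47 / 50) (min 1 ((t₀₀ + t₁₁) / 2)))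
    (hh : h = max (39 / 50 * a) (min (17 / 20 * a) (Real.sqrt 6 / 3 * t₂₂)))
    (ha' : a' = min 1 (a + 1 / 4 * max 0 (Real.sqrt 6 / 3 * t₂₂ - 17 / 20 * a)))
    (hh' : h' = max (39 / 50 * a') (min (17 / 20 * a') (Real.sqrt 6 / 3 * t₂₂)))
    (hS : (t₀₀ - a) ^ 2 + (t₁₁ - a) ^ 2 + (t₂₂ - h / (Real.sqrt 6 / 3)) ^ 2 ≤ 1 / 100) :
    (t₀₀ - a') ^ 2 + (t₁₁ - a') ^ 2 + (t₂₂ - h' / (Real.sqrt 6 / 3)) ^ 2 ≤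
      (t₀₀ - a) ^ 2 + (t₁₁ - a) ^ 2 + (t₂₂ - h / (Real.sqrt 6 / 3)) ^ 2 + 1 / 100 := by
  obtain ⟨ha1, ha2, -, -⟩ := tri_pi_mem_box t₀₀ t₁₁ t₂₂ a h ha hh
  rcases le_or_gt (Real.sqrt 6 / 3 * t₂₂) (17 / 20 * a) with hω | hω
  · obtain ⟨e1, e2⟩ := tri_oblique_inactive hh ha' hh' ha2 hω
    rw [e1, e2]; linarith
  · obtain ⟨-, hle1, hle2, -, e2⟩ := tri_oblique_active ha' hh' (by linarith) ha2 hω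
    obtain ⟨e1, hωle⟩ := tri_oblique_overshoot_le hh (by linarith) hω (by nlinarith [sq_nonneg (t₀₀ - a), sq_nonneg (t₁₁ - a)])
    -- shifts `p = a′ − a ∈ [0, ω/4]`, `(h′ − h)/h₀ = κ p`, `κ = (17/20)/h₀ ≤ 85/78`
    have h6 : 0 < Real.sqrt 6 / 3 := by positivity
    have h6up : Real.sqrt 6 / 3 ≤ 49 / 60 := by
      have : Real.sqrt 6 ≤ 49 / 20 := by
        rw [show ((49 : ℝ) / 20) = Real.sqrt ((49 / 20) ^ 2) by rw [Real.sqrt_sq (by norm_num)]]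
        exact Real.sqrt_le_sqrt (by norm_num)
      linarith
    have h6lo : 39 / 50 ≤ Real.sqrt 6 / 3 := by
      have : (39 : ℝ) / 50 * 3 ≤ Real.sqrt 6 := by
        rw [show ((39 : ℝ) / 50 * 3) = Real.sqrt ((39 / 50 * 3) ^ 2) by rw [Real.sqrt_sq (by norm_num)]]
        exact Real.sqrt_le_sqrt (by norm_num)
      linarith
    set p := a' - a with hp
    have hp0 : 0 ≤ p := by linarith
    have hp1 : p ≤ 49 / 2400 := by linarith
    set κ := 17 / 20 / (Real.sqrt 6 / 3) with hκ
    have hκ0 : 0 ≤ κ := by positivity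
    have hκ1 : κ ≤ 85 / 78 := by
      rw [hκ, div_le_iff₀ h6]; linarith
    set x := t₀₀ - a with hx
    set y := t₁₁ - a with hy
    set z := t₂₂ - h / (Real.sqrt 6 / 3) with hz
    set w := x + y + κ * z with hw
    have er : t₂₂ - h' / (Real.sqrt 6 / 3) = z - κ * p := by
      rw [hz, e2, e1, hp, hκ]; field_simp; ring
    have ex : t₀₀ - a' = x - p := by rw [hx, hp]; ring
    have ey : t₁₁ - a' = y - p := by rw [hy, hp]; ring
    rw [ex, ey, er]
    have eF : (x - p) ^ 2 + (y - p) ^ 2 + (z - κ * p) ^ 2 = x ^ 2 + y ^ 2 + z ^ 2 + (-2 * p * w + (2 + κ ^ 2) * p ^ 2) := by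
      rw [hw]; ring
    rw [eF]
    -- Cauchy–Schwarz: `w² ≤ (2 + κ²)(x² + y² + z²) ≤ (2 + (85/78)²)/100`
    have hCS : w ^ 2 ≤ (2 + κ ^ 2) * (x ^ 2 + y ^ 2 + z ^ 2) := by
      rw [hw]; nlinarith [sq_nonneg (x - y), sq_nonneg (κ * x - z), sq_nonneg (κ * y - z)]
    clear_value w z y x κ p
    clear eF er ex ey e1 e2 hle1 hle2 hw hz hy hx hκ hp hωle hω h6up h6lo h6 ha hh ha' hh' ha1 ha2
    have hκ2 : κ ^ 2 ≤ (85 / 78) ^ 2 := pow_le_pow_left₀ hκ0 hκ1 2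
    have hxyz : x ^ 2 + y ^ 2 + z ^ 2 ≤ 1 / 100 := hS
    have hw2 : w ^ 2 ≤ (2 + (85 / 78) ^ 2) * (1 / 100) := by
      have hpos : 0 ≤ x ^ 2 + y ^ 2 + z ^ 2 := by positivity
      have h1 : (2 + κ ^ 2) * (x ^ 2 + y ^ 2 + z ^ 2) ≤ (2 + (85 / 78) ^ 2) * (x ^ 2 + y ^ 2 + z ^ 2) :=
        mul_le_mul_of_nonneg_right (by linarith) hpos
      have h2 : (2 + (85 / 78 : ℝ) ^ 2) * (x ^ 2 + y ^ 2 + z ^ 2) ≤ (2 + (85 / 78) ^ 2) * (1 / 100) :=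
        mul_le_mul_of_nonneg_left hxyz (by norm_num)
      linarith
    -- AM–GM: `−2pw·θ ≤ p (w² + θ²)`, `θ = 9/50`
    have k1 : -2 * p * w * (9 / 50) ≤ p * w ^ 2 + p * (9 / 50) ^ 2 := by
      nlinarith [mul_nonneg hp0 (sq_nonneg (w + 9 / 50))]
    have k2 : p * w ^ 2 ≤ p * ((2 + (85 / 78) ^ 2) * (1 / 100)) := mul_le_mul_of_nonneg_left hw2 hp0
    have k3 : (2 + κ ^ 2) * p ^ 2 ≤ (2 + (85 / 78) ^ 2) * p ^ 2 :=
      mul_le_mul_of_nonneg_right (by linarith) (sq_nonneg p)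
    have k4 : p ^ 2 ≤ 49 / 2400 * p := by nlinarith
    nlinarith [k1, k2, k3, k4]

end Summit.AtomisticToContinuum.Crystallization.Theorems.NashClassCertificatesNashNearField

end
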